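import Summits.QuantumFields.YangMills.Theorems.FluctuationComparisonRegPrIntLS2BetaWhitneyHatLiftRelative
import HarnessLib

/-!
# (BG∞) ∕ `hsupp⁺` — LEMMA (G3) OF UV3-NODE §116.4: THE GEODESIC INTERPOLATION `s ↦ m·expPoint(s·logVec(m⁻¹a))` ON `SU(2)` — endpoints, reversal,
# position on the segment, the AXIAL step `dist1 ≤ |s − s′|·‖logVec(m⁻¹a)‖ ≤ |s − s′|·π`, and the TRANSVERSE step as a chart identity (`= dist1(expPoint(sX)·expPoint(sX′)⁻¹)`)
# with its hemisphere instance (factor 1, ✓`dist1_expPoint_smul_mul_inv_le`) — the two legs of Stage I's filling and the rays of Stages T∕S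

Cell `ym3-torus` (YM ladder rung R3 = continuum `SU(2)` Yang–Mills on the three-torus at fixed lattice data — a RUNG: NOT d = 4, NOT infinite volume, NOT a mass gap,
NOT Clay).  Width seat «width 5» `ym3-torus-px5` (gen 24), FREE px helper on crux `stmt-QuantumFields-20520` (`…Theses.UnitScaleTilt.FluctuationComparisonRegPrIntL`);
`--kind proof --supports stmt-QuantumFields-20520 --as helper`, count-neutral, DEFINITION-FREE (0 `def`, 0 `instance`, 0 `notation`, 0 `sorry`; default heartbeats): the
interpolant is written out as the term `m * expPoint (s • logVec (su2Quat (m⁻¹ * a)))` in every statement.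

WHY (architect-lineage RULING «(BG∞) PLAN OF RECORD = UV3-NODE §116» 2026-09-01 00:13:02Z, name «px5 g24 ← (G3) two-leg geodesic interpolation»).  D-GUARD's one open supplier on
the floored road is `hsupp^{≥J₀}` above the height floor; its plan of record (px19 g25 §116.3) glues block-axial gauges at scale `ρ = c₀θ^{−1∕2}` in eight colour classes, and every
filling stage moves group elements along GEODESIC SEGMENTS of `SU(2) ≅ S³`: Stage I interpolates between two near-constant face values through a midpoint `m_Q` («two legs»:
face value → `m_Q` → opposite face value), Stages T∕S cone toward a point along the same segments.  What those stages consume from the segment `s ↦ geo(m, a; s)` is exactly: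
where it starts and ends, where it sits (`‖logVec(m⁻¹·geo)‖ = s·‖logVec(m⁻¹a)‖`, so «no cut locus» bookkeeping is arithmetic), how much one AXIAL step `s → s′` costs
(`≤ |s − s′|·π`, uniformly — the `2·1.84∕ρ`-type terms of §116.3), and that the TRANSVERSE comparison of two segments from the same base `m` toward `a`, `a′` IS the chart comparison
`dist1(expPoint(sX)·expPoint(sX′)⁻¹)` (`X = logVec(m⁻¹a)`, `X′ = logVec(m⁻¹a′)`) with `dist1(expPoint X·expPoint X′⁻¹) = dist1(a·a′⁻¹)` — so ANY cone lemma in the chart (the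
hemisphere contraction ✓`dist1_expPoint_smul_mul_inv_le`, factor 1; px19 g25's ⧗(G5) off-cap edition, factor `s·(π − r)∕sin r`) plugs in by `rw`.  This file is (G3).

WHAT IS PROVED (sorry-free; `m a a′ : SU2`, `s s′ : ℝ`, `X := logVec (su2Quat (m⁻¹ * a))`).
§1 THE SEGMENT: `interp_zero` (`s = 0` ↦ `m`), `interp_one` (`s = 1` ↦ `a`, lit ✓`expPoint_logVec`), `inv_mul_interp` (`m⁻¹ · geo = expPoint (s • X)`), ★`norm_logVec_inv_mul_interp`
  (POSITION: `‖logVec (su2Quat (m⁻¹ * geo))‖ = s * ‖X‖` for `0 ≤ s ≤ 1`), `interp_eq_end_mul` (REVERSAL: `geo = a * expPoint ((s − 1) • X)`), ★`norm_logVec_end_inv_mul_interp`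
  (`‖logVec (su2Quat (a⁻¹ * geo))‖ = (1 − s) * ‖X‖`): the interpolant lies on the minimal geodesic, at arc `s·d` from `m` and `(1−s)·d` from `a`, `d = ‖X‖ ≤ π`.
§2 THE AXIAL STEP: ★★`dist1_interp_mul_interp_inv_eq` (`dist1 (geo s · (geo s′)⁻¹) = dist1 (expPoint ((s − s′) • X))` — conjugation invariance, NO commutator), ★★`dist1_interp_step_le`
  (`≤ |s − s′| * ‖X‖`), ★★`dist1_interp_step_le_pi` (`≤ |s − s′| * π`).
§3 THE TRANSVERSE STEP: ★★`dist1_interp_mul_interp_inv_eq_chart` (same base `m`, targets `a a′`, same `s`: `dist1 (geo(m,a;s) · geo(m,a′;s)⁻¹) = dist1 (expPoint (s • X) · (expPoint (s • X′))⁻¹)`),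
  `dist1_expPoint_logVec_mul_inv_eq` (`dist1 (expPoint X · (expPoint X′)⁻¹) = dist1 (a · a′⁻¹)`), ★★★`dist1_interp_transverse_le_hemisphere` (`‖X‖, ‖X′‖ ≤ π∕2`, `0 ≤ s ≤ 1` ⟹
  `dist1 (geo(m,a;s) · geo(m,a′;s)⁻¹) ≤ dist1 (a · a′⁻¹)` — ✓`dist1_expPoint_smul_mul_inv_le` transported), ★★★`dist1_interp_transverse_le_of_cone` (ANY cone letter
  `dist1 (expPoint (s•X) · (expPoint (s•X′))⁻¹) ≤ C` ⟹ the same bound for the interpolants — the socket for ⧗(G5)'s off-cap factor), and the COMMON-TARGET forms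
  `logVec_su2Quat_inv_eq_neg` ∕ `interp_swap` (off the cut locus `‖X‖ < π`: `log(g⁻¹) = −log g`, `geo(a,m;s) = geo(m,a;1−s)`), ★★`dist1_interp_commonTarget_eq_chart` ∕
  ★★★`…_le_hemisphere` ∕ ★★★`…_le_of_cone` (segments from `a`, `a′` TO the same `m`, compared at the same `s` = the common-base comparison at `1 − s` — the first leg of Stage I,
  whose base points are the varying face values and whose target is the fixed midpoint).

DOMAIN SENTENCE (RULING №115 R5).  Pure `SU(2)` chart geometry; holds for all group elements; the hemisphere editions carry their `π∕2` hypotheses explicitly, the off-cap factor is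
px19 g25's (G5) (not restated here).  Nothing of the lattice, of the blocks, of `hsupp⁺` itself.

HONEST SCOPE.  [folklore] spherical geometry through the tree's quaternion chart (lit ✓`expPoint`∕`logVec`∕`expPoint_logVec`∕`dist1_expPoint_le`; ✓`expPoint_add_smul`,
✓`dist1_expPoint_smul_mul_inv_le`, ✓`norm_logVec_su2Quat_expPoint`); `hsupp⁺` ∕ (BG∞) is a CONJECTURE with a plan (§116) and numerics (FL-39), NOT proved; (G4)–(G8) OPEN;
nothing of Bałaban's renormalisation-group analysis asserted or proved ([Balaban1985RegularSpaces] (1.29) p.81, (1.36) p.82 are the printed LOCAL small-bond gauges this road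
globalises); `hsupp^{≥J₀}`, hD, hDBX, h3 HYPOTHESES; GAP♯∘ (registry v11 3732b7df; v12.1 adopted-in-waiting), the five registered stubs (0∕5), S2β, 20520, 19936, 19200,
`YM3TorusSU2` NOT proved; no registered stub closed; rung R3 — NOT d = 4, NOT infinite volume, NOT a mass gap, NOT Clay; the Yang–Mills mass gap is NOT proved.
-/

set_option autoImplicit false

noncomputable section

namespace Summit.QuantumFields.YangMills.Theorems.FluctuationComparisonRegPrIntLS2BetaGeodesicInterpolationSU2

open scoped Real RealInnerProductSpace
open Literature.MathematicalPhysics.QuantumLattice (su2Quat norm_su2Quat)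
open Literature.MathematicalPhysics.QuantumFieldTheory.Balaban1983to89
open T4CubeChartGnomonic (SU2)
open T4HaarSU2ExpChart (expPoint expPoint_zero su2Quat_expPoint)
open T4ExpWindowSmallField (logVec norm_logVec norm_logVec_le_pi expPoint_logVec dist1_expPoint_le dist1_eq_two_mul_sin)
open Summit.QuantumFields.YangMills.Theorems.FluctuationComparisonRegPrIntLS2BetaDistributedHolonomySU2 (expPoint_add_smul dist1_expPoint_smul_mul_inv_le)
open Summit.QuantumFields.YangMills.Theorems.FluctuationComparisonRegPrIntLS2BetaGeodesicJensenLift (norm_logVec_su2Quat_expPoint)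
open Summit.QuantumFields.YangMills.Theorems.FluctuationComparisonRegPrIntLS2BetaWhitneyHatLiftRelative (logVec_su2Quat_expPoint)

/-! ## §1 The segment: endpoints, position, reversal -/

/-- At `s = 0` the interpolant is the base point `m`. [folklore] -/
theorem interp_zero (m a : SU2) : m * expPoint ((0 : ℝ) • logVec (su2Quat (m⁻¹ * a))) = m := by
  rw [zero_smul, expPoint_zero, mul_one]

/-- At `s = 1` the interpolant is the target `a` (the chart round trip ✓`expPoint_logVec`). [folklore] -/
theorem interp_one (m a : SU2) : m * expPoint ((1 : ℝ) • logVec (su2Quat (m⁻¹ * a))) = a := by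
  rw [one_smul, expPoint_logVec, mul_inv_cancel_left]

/-- Seen from the base: `m⁻¹ · geo(m,a;s) = expPoint (s • X)`. [folklore] -/
theorem inv_mul_interp (m a : SU2) (s : ℝ) :
    m⁻¹ * (m * expPoint (s • logVec (su2Quat (m⁻¹ * a)))) = expPoint (s • logVec (su2Quat (m⁻¹ * a))) := by
  rw [inv_mul_cancel_left]

/-- ★ **POSITION ON THE SEGMENT**: for `0 ≤ s ≤ 1` the interpolant sits at arc `s·‖X‖` from the base (`‖X‖ ≤ π` always, so `‖sX‖ ≤ π` and the chart is exact there). [folklore] -/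
theorem norm_logVec_inv_mul_interp (m a : SU2) {s : ℝ} (hs0 : 0 ≤ s) (hs1 : s ≤ 1) :
    ‖logVec (su2Quat (m⁻¹ * (m * expPoint (s • logVec (su2Quat (m⁻¹ * a))))))‖ = s * ‖logVec (su2Quat (m⁻¹ * a))‖ := by
  rw [inv_mul_cancel_left]
  have hX : ‖logVec (su2Quat (m⁻¹ * a))‖ ≤ π := norm_logVec_le_pi _
  have hsX : ‖s • logVec (su2Quat (m⁻¹ * a))‖ ≤ π := by
    rw [norm_smul, Real.norm_eq_abs, abs_of_nonneg hs0]
    calc s * ‖logVec (su2Quat (m⁻¹ * a))‖ ≤ 1 * π := mul_le_mul hs1 hX (norm_nonneg _) zero_le_one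
      _ = π := one_mul _
  rw [norm_logVec_su2Quat_expPoint hsX, norm_smul, Real.norm_eq_abs, abs_of_nonneg hs0]

/-- **REVERSAL**: the same point seen from the target, `geo(m,a;s) = a · expPoint ((s − 1) • X)` (the ray is a one-parameter group, ✓`expPoint_add_smul`; `m · expPoint X = a`). [folklore] -/
theorem interp_eq_end_mul (m a : SU2) (s : ℝ) :
    m * expPoint (s • logVec (su2Quat (m⁻¹ * a))) = a * expPoint ((s - 1) • logVec (su2Quat (m⁻¹ * a))) := by
  have hX : expPoint ((1 : ℝ) • logVec (su2Quat (m⁻¹ * a))) = m⁻¹ * a := by rw [one_smul, expPoint_logVec]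
  calc m * expPoint (s • logVec (su2Quat (m⁻¹ * a)))
      = m * expPoint ((1 + (s - 1)) • logVec (su2Quat (m⁻¹ * a))) := by rw [show (1 : ℝ) + (s - 1) = s by ring]
    _ = m * (expPoint ((1 : ℝ) • logVec (su2Quat (m⁻¹ * a))) * expPoint ((s - 1) • logVec (su2Quat (m⁻¹ * a)))) := by rw [expPoint_add_smul]
    _ = a * expPoint ((s - 1) • logVec (su2Quat (m⁻¹ * a))) := by rw [hX, ← mul_assoc, mul_inv_cancel_left]

/-- ★ **POSITION FROM THE TARGET**: for `0 ≤ s ≤ 1`, `‖logVec (su2Quat (a⁻¹ · geo(m,a;s)))‖ = (1 − s)·‖X‖`. [folklore] -/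
theorem norm_logVec_end_inv_mul_interp (m a : SU2) {s : ℝ} (hs0 : 0 ≤ s) (hs1 : s ≤ 1) :
    ‖logVec (su2Quat (a⁻¹ * (m * expPoint (s • logVec (su2Quat (m⁻¹ * a))))))‖ = (1 - s) * ‖logVec (su2Quat (m⁻¹ * a))‖ := by
  rw [interp_eq_end_mul, inv_mul_cancel_left]
  have hX : ‖logVec (su2Quat (m⁻¹ * a))‖ ≤ π := norm_logVec_le_pi _
  have h1s : 0 ≤ 1 - s := by linarith
  have hsX : ‖(s - 1) • logVec (su2Quat (m⁻¹ * a))‖ ≤ π := by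
    rw [norm_smul, Real.norm_eq_abs, show |s - 1| = 1 - s by rw [abs_sub_comm]; exact abs_of_nonneg h1s]
    calc (1 - s) * ‖logVec (su2Quat (m⁻¹ * a))‖ ≤ 1 * π := mul_le_mul (by linarith) hX (norm_nonneg _) zero_le_one
      _ = π := one_mul _
  rw [norm_logVec_su2Quat_expPoint hsX, norm_smul, Real.norm_eq_abs, show |s - 1| = 1 - s by rw [abs_sub_comm]; exact abs_of_nonneg h1s]

/-! ## §2 The axial step: two parameters on one segment -/

/-- ★★ **TWO POINTS OF ONE SEGMENT DIFFER BY A RAY ELEMENT, UP TO CONJUGATION**: `dist1 (geo(s) · geo(s′)⁻¹) = dist1 (expPoint ((s − s′) • X))`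
(`geo(s) = geo(s′) · expPoint((s − s′)X)` by ✓`expPoint_add_smul`, then `dist1 (h·g·h⁻¹) = dist1 g`). [folklore] -/
theorem dist1_interp_mul_interp_inv_eq (m a : SU2) (s s' : ℝ) :
    dist1 (m * expPoint (s • logVec (su2Quat (m⁻¹ * a))) * (m * expPoint (s' • logVec (su2Quat (m⁻¹ * a))))⁻¹) =
      dist1 (expPoint ((s - s') • logVec (su2Quat (m⁻¹ * a)))) := by
  set X := logVec (su2Quat (m⁻¹ * a)) with hX
  have hsplit : expPoint (s • X) = expPoint (s' • X) * expPoint ((s - s') • X) := by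
    rw [← expPoint_add_smul, show s' + (s - s') = s by ring]
  rw [hsplit, ← mul_assoc]
  exact GaugeGroup.dist1_conj _ _

/-- ★★ **THE AXIAL STEP**: `dist1 (geo(s) · geo(s′)⁻¹) ≤ |s − s′| · ‖X‖` (lit ✓`dist1_expPoint_le`: the chord is at most the arc). [folklore] -/
theorem dist1_interp_step_le (m a : SU2) (s s' : ℝ) :
    dist1 (m * expPoint (s • logVec (su2Quat (m⁻¹ * a))) * (m * expPoint (s' • logVec (su2Quat (m⁻¹ * a))))⁻¹) ≤
      |s - s'| * ‖logVec (su2Quat (m⁻¹ * a))‖ := by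
  rw [dist1_interp_mul_interp_inv_eq]
  refine (dist1_expPoint_le _).trans (le_of_eq ?_)
  rw [norm_smul, Real.norm_eq_abs]

/-- ★★ **THE AXIAL STEP, UNIFORMLY**: `dist1 (geo(s) · geo(s′)⁻¹) ≤ |s − s′| · π` (every arc is `≤ π`, lit ✓`norm_logVec_le_pi`) — a segment traversed in `n` equal steps costs
`≤ π∕n` per step whatever its endpoints. [folklore] -/
theorem dist1_interp_step_le_pi (m a : SU2) (s s' : ℝ) :
    dist1 (m * expPoint (s • logVec (su2Quat (m⁻¹ * a))) * (m * expPoint (s' • logVec (su2Quat (m⁻¹ * a))))⁻¹) ≤ |s - s'| * π :=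
  (dist1_interp_step_le m a s s').trans (mul_le_mul_of_nonneg_left (norm_logVec_le_pi _) (abs_nonneg _))

/-! ## §3 The transverse step: two segments from one base, compared at the same parameter -/

/-- ★★ **TRANSVERSE COMPARISON IS A CHART COMPARISON**: for segments from the same base `m` toward `a` and `a′`,
`dist1 (geo(m,a;s) · geo(m,a′;s)⁻¹) = dist1 (expPoint (s • X) · (expPoint (s • X′))⁻¹)` (left translation by `m` is an isometry of `dist1`: conjugation invariance). [folklore] -/
theorem dist1_interp_mul_interp_inv_eq_chart (m a a' : SU2) (s : ℝ) :
    dist1 (m * expPoint (s • logVec (su2Quat (m⁻¹ * a))) * (m * expPoint (s • logVec (su2Quat (m⁻¹ * a'))))⁻¹) =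
      dist1 (expPoint (s • logVec (su2Quat (m⁻¹ * a))) * (expPoint (s • logVec (su2Quat (m⁻¹ * a'))))⁻¹) := by
  rw [mul_inv_rev, show m * expPoint (s • logVec (su2Quat (m⁻¹ * a))) * ((expPoint (s • logVec (su2Quat (m⁻¹ * a'))))⁻¹ * m⁻¹) =
    m * (expPoint (s • logVec (su2Quat (m⁻¹ * a))) * (expPoint (s • logVec (su2Quat (m⁻¹ * a'))))⁻¹) * m⁻¹ by group]
  exact GaugeGroup.dist1_conj _ _

/-- At `s = 1` the chart comparison is the data's: `dist1 (expPoint X · (expPoint X′)⁻¹) = dist1 (a · a′⁻¹)` (`expPoint X = m⁻¹a`, `expPoint X′ = m⁻¹a′`, conjugation by `m⁻¹`). [folklore] -/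
theorem dist1_expPoint_logVec_mul_inv_eq (m a a' : SU2) :
    dist1 (expPoint (logVec (su2Quat (m⁻¹ * a))) * (expPoint (logVec (su2Quat (m⁻¹ * a'))))⁻¹) = dist1 (a * a'⁻¹) := by
  rw [expPoint_logVec, expPoint_logVec, mul_inv_rev, inv_inv,
    show m⁻¹ * a * (a'⁻¹ * m) = m⁻¹ * (a * a'⁻¹) * m⁻¹⁻¹ by rw [inv_inv]; group]
  exact GaugeGroup.dist1_conj _ _

/-- ★★★ **THE TRANSVERSE STEP ON THE HEMISPHERE** (factor 1): if both targets are within arc `π∕2` of the base, the interpolants at the same `s ∈ [0,1]` are no farther apart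
than the targets: `dist1 (geo(m,a;s) · geo(m,a′;s)⁻¹) ≤ dist1 (a · a′⁻¹)` — ✓`dist1_expPoint_smul_mul_inv_le` (px12 g22) transported by §3's two identities.
[cite: Balaban1985RegularSpaces, (1.36) p.82] -/
theorem dist1_interp_transverse_le_hemisphere (m a a' : SU2) (ha : ‖logVec (su2Quat (m⁻¹ * a))‖ ≤ π / 2) (ha' : ‖logVec (su2Quat (m⁻¹ * a'))‖ ≤ π / 2)
    {s : ℝ} (hs0 : 0 ≤ s) (hs1 : s ≤ 1) :
    dist1 (m * expPoint (s • logVec (su2Quat (m⁻¹ * a))) * (m * expPoint (s • logVec (su2Quat (m⁻¹ * a'))))⁻¹) ≤ dist1 (a * a'⁻¹) := by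
  rw [dist1_interp_mul_interp_inv_eq_chart, ← dist1_expPoint_logVec_mul_inv_eq m a a']
  exact dist1_expPoint_smul_mul_inv_le _ _ ha ha' hs0 hs1

/-- ★★★ **THE TRANSVERSE STEP FROM ANY CONE LETTER** (the socket for the off-cap edition): whatever bound `C` a chart lemma gives for
`dist1 (expPoint (s•X) · (expPoint (s•X′))⁻¹)` is a bound for the interpolants at parameter `s`. [folklore] -/
theorem dist1_interp_transverse_le_of_cone (m a a' : SU2) (s : ℝ) {C : ℝ}
    (hcone : dist1 (expPoint (s • logVec (su2Quat (m⁻¹ * a))) * (expPoint (s • logVec (su2Quat (m⁻¹ * a'))))⁻¹) ≤ C) :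
    dist1 (m * expPoint (s • logVec (su2Quat (m⁻¹ * a))) * (m * expPoint (s • logVec (su2Quat (m⁻¹ * a'))))⁻¹) ≤ C := by
  rwa [dist1_interp_mul_interp_inv_eq_chart]

/-- **THE INVERSE'S LOGARITHM OFF THE CUT LOCUS**: `logVec (g⁻¹) = −logVec g` when `‖logVec g‖ < π` (at the cut locus `g = −1` both logarithms are a CHOSEN vector of norm `π`
and the identity may fail — hence the strict hypothesis). [folklore] -/
theorem logVec_su2Quat_inv_eq_neg (g : SU2) (hg : ‖logVec (su2Quat g)‖ < π) : logVec (su2Quat g⁻¹) = -logVec (su2Quat g) := by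
  have hinv : g⁻¹ = expPoint ((-1 : ℝ) • logVec (su2Quat g)) := by
    have h2 : expPoint ((1 : ℝ) • logVec (su2Quat g)) * expPoint ((-1 : ℝ) • logVec (su2Quat g)) = 1 := by
      rw [← expPoint_add_smul, show (1 : ℝ) + -1 = 0 by ring, zero_smul, expPoint_zero]
    rw [one_smul, expPoint_logVec] at h2
    exact inv_eq_of_mul_eq_one_right h2
  rw [hinv, logVec_su2Quat_expPoint (by rw [norm_smul, Real.norm_eq_abs, abs_neg, abs_one, one_mul]; exact hg), neg_one_smul]

/-- **REVERSAL OF THE PARAMETRISATION OFF THE CUT LOCUS**: the segment from `a` to `m` at parameter `s` is the segment from `m` to `a` at parameter `1 − s`: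
`a · expPoint (s • logVec (a⁻¹m)) = m · expPoint ((1 − s) • logVec (m⁻¹a))` when `‖logVec (m⁻¹a)‖ < π` (antipodal pairs have two chosen semicircles, which may differ). [folklore] -/
theorem interp_swap (m a : SU2) (ha : ‖logVec (su2Quat (m⁻¹ * a))‖ < π) (s : ℝ) :
    a * expPoint (s • logVec (su2Quat (a⁻¹ * m))) = m * expPoint ((1 - s) • logVec (su2Quat (m⁻¹ * a))) := by
  rw [show a⁻¹ * m = (m⁻¹ * a)⁻¹ by rw [mul_inv_rev, inv_inv], logVec_su2Quat_inv_eq_neg _ ha, smul_neg, ← neg_smul,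
    interp_eq_end_mul m a (1 - s), show (1 : ℝ) - s - 1 = -s by ring]

/-- ★★ **COMMON TARGET, CHART FORM** (Stage I's first leg: the base points `a`, `a′` vary over a face, the target `m` is the fixed midpoint; both within arc `< π` of `m`):
`dist1 (geo(a,m;s) · geo(a′,m;s)⁻¹) = dist1 (expPoint ((1 − s) • X) · (expPoint ((1 − s) • X′))⁻¹)`, `X = logVec(m⁻¹a)`, `X′ = logVec(m⁻¹a′)` — by `interp_swap` this is §3's
common-base identity at parameter `1 − s`. [folklore] -/
theorem dist1_interp_commonTarget_eq_chart (m a a' : SU2) (ha : ‖logVec (su2Quat (m⁻¹ * a))‖ < π) (ha' : ‖logVec (su2Quat (m⁻¹ * a'))‖ < π) (s : ℝ) :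
    dist1 (a * expPoint (s • logVec (su2Quat (a⁻¹ * m))) * (a' * expPoint (s • logVec (su2Quat (a'⁻¹ * m))))⁻¹) =
      dist1 (expPoint ((1 - s) • logVec (su2Quat (m⁻¹ * a))) * (expPoint ((1 - s) • logVec (su2Quat (m⁻¹ * a'))))⁻¹) := by
  rw [interp_swap m a ha, interp_swap m a' ha']
  exact dist1_interp_mul_interp_inv_eq_chart m a a' (1 - s)

/-- ★★★ **COMMON TARGET ON THE HEMISPHERE** (factor 1): face values `a`, `a′` within arc `π∕2` of the midpoint `m` ⟹ at every `s ∈ [0,1]` the first-leg interpolants are no farther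
apart than `a` and `a′`: `dist1 (geo(a,m;s) · geo(a′,m;s)⁻¹) ≤ dist1 (a · a′⁻¹)`. [cite: Balaban1985RegularSpaces, (1.36) p.82] -/
theorem dist1_interp_commonTarget_le_hemisphere (m a a' : SU2) (ha : ‖logVec (su2Quat (m⁻¹ * a))‖ ≤ π / 2) (ha' : ‖logVec (su2Quat (m⁻¹ * a'))‖ ≤ π / 2)
    {s : ℝ} (hs0 : 0 ≤ s) (hs1 : s ≤ 1) :
    dist1 (a * expPoint (s • logVec (su2Quat (a⁻¹ * m))) * (a' * expPoint (s • logVec (su2Quat (a'⁻¹ * m))))⁻¹) ≤ dist1 (a * a'⁻¹) := by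
  have hπ : 0 < π := Real.pi_pos
  rw [dist1_interp_commonTarget_eq_chart m a a' (by linarith) (by linarith) s, ← dist1_expPoint_logVec_mul_inv_eq m a a']
  exact dist1_expPoint_smul_mul_inv_le _ _ ha ha' (by linarith) (by linarith)

/-- ★★★ **COMMON TARGET FROM ANY CONE LETTER** (socket for the off-cap edition at parameter `1 − s`). [folklore] -/
theorem dist1_interp_commonTarget_le_of_cone (m a a' : SU2) (ha : ‖logVec (su2Quat (m⁻¹ * a))‖ < π) (ha' : ‖logVec (su2Quat (m⁻¹ * a'))‖ < π) (s : ℝ) {C : ℝ}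
    (hcone : dist1 (expPoint ((1 - s) • logVec (su2Quat (m⁻¹ * a))) * (expPoint ((1 - s) • logVec (su2Quat (m⁻¹ * a'))))⁻¹) ≤ C) :
    dist1 (a * expPoint (s • logVec (su2Quat (a⁻¹ * m))) * (a' * expPoint (s • logVec (su2Quat (a'⁻¹ * m))))⁻¹) ≤ C := by
  rwa [dist1_interp_commonTarget_eq_chart m a a' ha ha' s]

end Summit.QuantumFields.YangMills.Theorems.FluctuationComparisonRegPrIntLS2BetaGeodesicInterpolationSU2

end
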